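import Summits.ResolutionOfSingularities.ResolutionOfSingularities.Theorems.EquisingularLiftEquisingularLiftNatInvFinal
import Summits.ResolutionOfSingularities.ResolutionOfSingularities.Theorems.EquisingularLiftEquisingularLiftNatTCPlusPlusInvDefs
import HarnessLib

/-!
# [OURS · L1 W4.5(b) · EL♮(3)] (δ) ASSEMBLY brick `inv_final″`: THE CURVE STEP FROM THE TC⁺⁺ INVARIANT — the `(final)` hypothesis of
# res-L1-w45b-stub-3's driver `hsub_reachTCPlusPlus_of_invariant` (p543222) at `INV := TCPlusPlus.Inv` (p547095), VERBATIM

Crux chain w45b (cell `res-hironaka`, slot W4.5(b)), working crux **EL♮** = stmt-ResolutionOfSingularities-20038, child **EL♮(3)** =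
stmt-ResolutionOfSingularities-20148, route EquisingularLift, line `sections`, registered stub `stub_elnat_tcPlusPlusPointResolution` (v2).
HONEST FRAMING: OURS; NOT a statement of any manuscript; AI-written, weaker than expert review. No `sorry`; standard axioms. DEF-FREE.
`--supports stmt-ResolutionOfSingularities-20148 --as helper` (res-type-100 g12; CHAIN v7.29 ask (e) «then the first (δ) ASSEMBLY filing»).

WHAT. **`inv_final''`**: the driver's `(final)` binder at `INV := TCPlusPlus.Inv O k θ P q Y Ch` — for a stage `(F₉, β₉, T₉, Z₉, X₉)` of the
inner chain carrying the TC⁺⁺ invariant, `Z₉ ⊆ T₉`, `T₉ ⊄ Z₉`, (finitely many non-regular points — unused) and the blowing up `υ′` of the reduced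
running curve `V(Z₉)`: an upstairs `Ch`-stage with a model square for `(F₁₀, closure υ′⁻¹(T₉ ∖ Z₉))`. PROOF: the member indexed by `S = ∅ ⊆ Cand`
makes `TCPlus.Inv … true` (res-L1-w45b-stub-1's INV DEFS v3, flag raised: no centred members owed), and res-L1-w45b-stub-1's `curveStep_of_inv`
(p535454) is stated for every flag.
-/

set_option linter.dupNamespace false -- mandated namespace `Summit.<Summit>.<Problem>` of this single-conjunct summit
set_option linter.overlappingInstances false -- signatures carry `[IsDomain O] [IsDiscreteValuationRing O]`

noncomputable section

open CategoryTheory CategoryTheory.Limits AlgebraicGeometry TopologicalSpace Topology IsLocalRing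
open Literature.AlgebraicGeometry.Resolution
open AlgebraicGeometry.Scheme.IdealSheafData
open Summit.ResolutionOfSingularities.ResolutionOfSingularities.Theses.EquisingularLift.Split
open Summit.ResolutionOfSingularities.ResolutionOfSingularities.Cruxes.EquisingularLift.StrataSplit

namespace Summit.ResolutionOfSingularities.ResolutionOfSingularities.Cruxes.EquisingularLiftNat.Sections

/-- **THE CURVE STEP FROM THE TC⁺⁺ INVARIANT** (the driver's `(final)` at `INV := TCPlusPlus.Inv`; see the module docstring).
[cite: Liu2002, Thm. 8.1.19] [OURS · L1 W4.5b] (δ) assembly toward `stub_elnat_tcPlusPlusPointResolution`; NOT a statement of the manuscript. -/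
theorem inv_final'' (O : Type) [CommRing O] [IsDomain O] [IsDiscreteValuationRing O] (k : Type) [Field k]
    (θ : O →+* k) (hθ : Function.Surjective θ)
    (P : Scheme.{0}) (q : P ⟶ Spec (.of O)) [IsProper q] (Y : Set P) (hYirr : IsIrreducible Y) (hYcl : IsClosed Y)
    (hPnoeth : IsLocallyNoetherian P) (hPreg : Scheme.IsRegular P)
    (Ch : ∀ X' : Scheme.{0}, (X' ⟶ P) → Set X' → Prop)
    (hChain : ∀ (X' : Scheme.{0}) (σ : X' ⟶ P) (S : Set X'), Ch X' σ S → Chain P Y X' σ S)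
    (hStep : ∀ (X' X'' : Scheme.{0}) (σ' : X' ⟶ P) (S' : Set X') (C : X'.IdealSheafData) (τ : X'' ⟶ X'),
      Ch X' σ' S' → IsBlowup τ C → Scheme.IsRegular C.subscheme → Flat (C.subschemeι ≫ σ' ≫ q) →
      σ' '' (C.support : Set X') ⊆ {x : P | ¬ IsGenericPoint x Y} →
      (C.support : Set X') ∩ (σ' ≫ q) ⁻¹' {IsLocalRing.closedPoint O} ⊆ S' →
      Ch X'' (τ ≫ σ') (closure (τ ⁻¹' (S' \ (C.support : Set X')))))
    {F₁ F₂ : Scheme.{0}} :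
    ∀ (W : Set F₁) (F₉ : Scheme.{0}) (β₉ : F₉ ⟶ F₂) (T₉ Z₉ X₉ : Set F₉) (hZ₉ : IsClosed Z₉) (F₁₀ : Scheme.{0}) (υ' : F₁₀ ⟶ F₉),
      TCPlusPlus.Inv O k θ P q Y Ch W F₉ β₉ T₉ Z₉ X₉ → (Z₉ ⊆ T₉) → (¬ (T₉ ⊆ Z₉)) →
      (Set.Finite {z : ↥((vanishingIdeal (⟨Z₉, hZ₉⟩ : Closeds F₉))).subscheme |
        ¬ IsRegularLocalRing (((vanishingIdeal (⟨Z₉, hZ₉⟩ : Closeds F₉))).subscheme.presheaf.stalk z)}) →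
      IsBlowup υ' (vanishingIdeal (⟨Z₉, hZ₉⟩ : Closeds F₉)) →
      ∃ (X₉ : Scheme.{0}) (σ₉ : X₉ ⟶ P) (S₉ : Set X₉) (j₉ : F₁₀ ⟶ X₉) (t₉ : F₁₀ ⟶ Spec (.of k)),
        Ch X₉ σ₉ S₉ ∧ IsIntegral X₉ ∧ IsLocallyNoetherian X₉ ∧ Scheme.IsRegular X₉ ∧ IsDominant (σ₉ ≫ q) ∧
        IsPullback j₉ t₉ (σ₉ ≫ q) (Spec.map (CommRingCat.ofHom θ)) ∧ j₉ '' closure (υ' ⁻¹' (T₉ \ Z₉)) = S₉ ∧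
        IsClosed (closure (υ' ⁻¹' (T₉ \ Z₉))) ∧ IsIrreducible (closure (υ' ⁻¹' (T₉ \ Z₉))) ∧ IsIntegral F₁₀ := by
  intro W F₉ β₉ T₉ Z₉ X₉ hZ₉ F₁₀ υ' hInv hZT hTZ _ hυ'
  obtain ⟨hint, hTcl, hTirr, hTZcl, hmem⟩ := hInv
  -- the `∅`-member raises the flag: `TCPlus.Inv … true`
  have hInv' : TCPlus.Inv O k θ P q Y Ch W F₉ β₉ T₉ Z₉ true :=
    ⟨hint, hTcl, hTirr, hTZcl, hmem ∅ (Set.empty_subset _), fun h => Bool.noConfusion h⟩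
  exact curveStep_of_inv O k θ hθ P q Y hYirr hYcl hPnoeth hPreg Ch hChain hStep W F₉ β₉ T₉ Z₉ true hInv' hZ₉ hZT hTZ F₁₀ υ' hυ'

end Summit.ResolutionOfSingularities.ResolutionOfSingularities.Cruxes.EquisingularLiftNat.Sections

end
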